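import Literature.Claims.NS.ClayVariants
import Literature.Analysis.FluidPDE.NSVorticity
import Literature.Analysis.FluidPDE.NSVorticityBKMHolds
import HarnessLib

/-!
# Claim skeleton: Kyritsis (2022), «A short and simple solution of the Millennium problem about the
# Navier–Stokes equations and similarly for the Euler equations»

Cell `ns-claims` (D-0090 NS-CLAIMS SWEEP), claim C03, typist `ns-claims-typist-3`.
UNREFEREED/DISPUTED CLAIM under adjudication — NOTHING in this file asserts a step: every `Step_k`
is a `Prop` (the paper's k-th load-bearing assertion, typed concretely so that `¬ Step_k` or its
vacuity can be a kernel theorem in the sibling file `Kyritsis2022Refutation.lean`), the only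
`theorem`s are the kernel COMPOSITIONS of the paper's own implications and unfolding lemmas.

Version of record: K. E. Kyritsis, J. Appl. Math. Phys. 10 (2022) 2538–2560,
doi:10.4236/jamp.2022.108172 (= HAL hal-03765480v1) [Kyritsis2022]; print page = HAL PDF page
+ 2536; materialised `pub/ns-claims/sources/Kyritsis2022/JAMP2022-hal-03765480/`, locators in
`sources/Kyritsis2022/LOCATORS.md` §1, §1a (ns-claims-lit-3). Earlier version of the SAME argument:
World J. Res. Rev. 13(2) (2021) 26–35, Thm 3.4 [Kyritsis2021]. The author's two OTHER arguments
(pressures via virtual work, preprint 2021 [Kyritsis2021b]; «conservation of particles» axiom, 2017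
[Kyritsis2017]) are separate claims C03b/C03c, not typed here.

## Claimed statement (as printed)

§5, p. 2556: «(Millennium Homogeneous Case A) … Take ν > 0 and n = 3. Let u₀(x) be any smooth,
divergent-free vector field satisfying (2.4). Take f(x,t) to be identically zero. Then there exist
smooth functions p(x,t), u(x,t) on R³ × [0,+∞) that satisfy (2.1), (2.2), (2.3), (2.6), (2.7).»;
p. 2557: «(Millennium Homogeneous Case B) … satisfying (8); we take f(x,t) to be identically zero.
Then there exist smooth functions p(x,t), u(x,t) on R³ × [0,+∞) that satisfy (2.1), (2.2), (2.3),
(2.10), (2.11).» with (2.10) = «u(x+eⱼ,t) = u(x,t), p(x+eⱼ,t) = p(x,t)» (p. 2541, the CMI-errata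
reading); Remark 5.1, p. 2557: «we could as well take ν = 0, and we would have the same proofs and
conclusions». Typed: `ClaimedTheorem` = Clay (A) ∧ errata-(B) ∧ their `ν = 0` (Euler) analogues, over
`ClayVariants.clayR3` / `clayPeriodicErrata` (ns-claims-lit-4).

## Clay delta (reference `ClayVariants.lean`)

Nearest: (A) — `ClaimedTheorem → clayR3.Regularity` is `And.left` (`clay_of_claimed`); summit-side
`clayR3.Regularity ↔ NavierStokesRegularity` is `Iff.rfl`. Axes: domain = (ℝ³ and ℤ³-periodic, both
claimed) · force ≡ 0 = · data (2.4) = (4) = · solution class C^∞ + (2.7) = · horizon [0,∞) = ·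
pressure: (2.10) includes `p` periodic = errata form (⇒ printed (B), `clayB_of_claimed`) · viscosity:
ν > 0 AND ν = 0 (Euler: STRONGER, Δ2). Not a «wrong problem» candidate: the claim implies (A).

## Steps (paper item · print page · typist's private flag)

* `Step_1`  Thm 2.1 + Rem. 2.4, pp. 2542–2543 (= Majda–Bertozzi Thm 3.4, Cor. 3.2): global-or-maximal
  smooth solution in the BKM class from a Clay datum, `ν ≥ 0`, with particle trajectories — plausible (known).
* `Step_2`  Thm 2.2, p. 2543 (= Majda–Bertozzi Thm 3.6, BKM): IS the tree fact
  `Literature.Analysis.FluidPDE.lintegral_iSup_curl_eq_top_of_not_hasSobolevExtensionPast` (discharged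
  in `NSVorticityBKMHolds.lean`) — true.
* `Step_3`  Rem. 2.1, p. 2541: Clay decay (2.4) ⇒ `sup |curl u₀| < ∞` — plausible (routine).
* `Step_4`  Lemma 3.1, p. 2547 («viscosity sign invariant»), in the form used at (4.9)–(4.10), p. 2552:
  the sign of the viscous line integral `∮_{c(t)} νΔu · dl` along a MATERIAL loop is constant in time — suspicious.
* `Step_5`  Lemma 4.1, p. 2549: ball averages of the `a`-component of the vorticity converge to the
  point value as `r → 0` — plausible (continuity) — PROVED in-file, `step_5_holds` (revision:
  `continuous_curl` and the convergence of ball averages of a continuous function).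
* `Step_6`  Lemma 4.2 (4.3), p. 2550, in its PRINTED generality («integration parametrization on any
  smooth 3D shape B of any size … as a diffeomorphic image of a spherical ball»): the disc-family flux
  average of the vorticity over ANY volume-preserving diffeomorphic image of a ball is `≤ sup |ω|` —
  known-false pattern (vortex stretching: the pulled-back vorticity `(DΦ)⁻¹ ω∘Φ` is not bounded by
  `sup |ω|`); its round-ball instance `Φ = id` is true.
* `Step_7`  Thm 4.1 (Kelvin, (4.1), p. 2548) integrated to Thm 4.2 ((4.4)–(4.5), pp. 2550–2551), with
  the «flow-image of a ball» convention of p. 2549: for EULER the flux average over the material image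
  is conserved — plausible (Cauchy's vorticity formula).
* `Step_8`  Thm 4.3 (4.6)/(4.10), pp. 2551–2552: for NS (`ν > 0`) the circulation along every material
  loop strictly DECREASES (orientation: the one in which it is positive) — suspicious (viscous diffusion
  of vorticity INTO a loop raises its circulation; `dΓ/dt = −ν∮ curl ω · dl` has no sign).
* `Step_9`  Thm 4.3 (4.7)/(4.8), pp. 2552–2553: the same monotonicity for the flux averages over
  material images of balls — suspicious (same reason).
* `Step_10` the passage (4.13)→(4.14), pp. 2554–2555 («we trace back on the trajectory … as the
  incompressible flow is volume preserving, the B(R, x₀) = B(R, x(tₙ)). We also utilize theorems 4.2,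
  4.3 and (4.5), (4.8), which prove that at the initial conditions t = 0, this average vorticity is
  the same or higher than that at tₙ»), LITERAL reading with ROUND balls at both times: the round-ball
  average of vorticity is non-increasing along a particle trajectory — known-false pattern (stretching).
* `Step_11` Thm 4.4, pp. 2553–2555, printed scope (Rem. 4.3 p. 2555: no finite energy / decay used;
  `ν ≥ 0`; periodic solutions are solutions on ℝ³): no blow-up of the point vorticity in finite time
  (`Theorem44Finite`) AND in infinite time (`Theorem44Infinite`).
* `Step_12` Remarks 2.5–2.6, p. 2543 («obviously … covers the periodic case too») with Thm 4.4 (2),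
  p. 2554, used in §5 Case (B) p. 2557: the periodic twin of Steps 1–3 (bounded initial vorticity and
  the global-or-blow-up alternative for smooth ℤ³-periodic data, `ν ≥ 0`, with trajectory maps; the
  blow-up branch carries (2.12)) — plausible (known).
Ordered index (TYPING-HYGIENE 11): Step 1 = `Step_1` (Thm 2.1, p. 2543) · Step 2 = `Step_2` (Thm 2.2,
p. 2543) · Step 3 = `Step_3` (Rem. 2.1, p. 2541) · Step 4 = `Step_4` (Lemma 3.1, p. 2547) · Step 5 =
`Step_5` (Lemma 4.1, p. 2549) · Step 6 = `Step_6` (Lemma 4.2, p. 2550) · Step 7 = `Step_7` (Thms 4.1–4.2,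
pp. 2548–2551) · Step 8 = `Step_8` (Thm 4.3 (4.6), pp. 2551–2552) · Step 9 = `Step_9` (Thm 4.3 (4.8),
pp. 2552–2553) · Step 10 = `Step_10` ((4.13)–(4.14), pp. 2554–2555) · Step 11 = `Step_11` (Thm 4.4,
pp. 2553–2555) · Step 12 = `Step_12` (Rems. 2.5–2.6 p. 2543, Thm 4.4 (2) p. 2554, §5 (B) p. 2557).

## COMPOSITION — proved as `claim_of_steps`

* `claim_of_steps : Step_1 → … → Step_12 → ClaimedTheorem` — PROVED; it consumes Steps 1, 2, 3, 5, 6,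
  7, 9, 12: Thm 4.4's finite-time clause is re-derived from the lemma-level steps by
  `theorem44Finite_of_steps : Step_5 → Step_6 → Step_7 → Step_9 → Theorem44Finite`, i.e. the proof
  of Thm 4.4 composes under the MATERIAL reading of (4.14) (the body at `t = 0` is the flow preimage
  of the round ball at `tₙ`, a «diffeomorphic image of a spherical ball» to which Lemma 4.2 is applied
  as printed); the suspicious links on this path are `Step_6` (p. 2550) and, for `ν > 0`, `Step_9`.
* `theorem44Finite_of_steps_literal : Step_5 → Step_6 → Step_10 → Theorem44Finite` — PROVED: under the
  LITERAL round-ball reading the decisive link is `Step_10` (pp. 2554–2555), which the paper justifies by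
  Thms 4.2/4.3 although these concern material images: `Step_7 ∧ Step_9 → Step_10` is NOT an
  implication of the typed objects (LOGIC candidate at p. 2555 if a refuter prefers that locator).
* `claim_of_thm44 : Step_1 → Step_2 → Step_3 → Step_11 → Step_12 → ClaimedTheorem` and the ℝ³-only
  `claimR3_of_steps : Step_1 → Step_2 → Step_3 → Step_11 → clayR3.Regularity ∧ clayR3.RegularityAt 0` —
  PROVED: §5's literal route through Thm 4.4 as printed (only its finite-time clause is used; the
  infinite-time clause has the further unprinted passage «∫₀^∞ ‖ω‖_∞ = ∞ ⇒ ω unbounded», p. 2554, and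
  is used nowhere in §5). `Step_4`, `Step_8` are the paper's printed support for `Step_9` and enter no
  kernel composition.

Design: physical space is `EuclideanSpace ℝ (Fin 3)` spelled out (no notation); solutions are the
tree's `IsClassicalNSSolutionOn S ν 0 u p` (`ν = 0` = Euler), vorticity the tree's `curl`, loops and
circulation the tree's `circulation`; particle-trajectory maps are the hypothesis structure `IsFlowOn`
(map AND inverse map, slice-wise smooth, volume preserving); Def. 4.1's «θ-integral of disc fluxes
divided by |B|» is typed in the reading that makes Lemmas 4.1/4.2 (round balls) TRUE — the volume
average of `⟪ω, a⟫` over the ball (`ballAvg`; the printed `dθ` without Jacobian would make Lemma 4.1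
false by the factor 3π/8) — and, for a diffeomorphic image `Φ(B)` with the pushed-forward discs, as
the volume average of the pulled-back vorticity `⟪DΨ(Φy) ω(Φy), a⟫`, `Ψ = Φ⁻¹` (`imageFluxAvg`; for
`det DΦ = 1` this IS the height-integrated flux through the image discs divided by `|Φ(B)| = |B|`,
by the cofactor identity `cof DΦ = (DΦ)⁻ᵀ`).

WHAT THIS IS NOT: not a claim about NS regularity or blow-up; not a claim about any author beyond the
typed locator.
-/

open MeasureTheory Set Filter
open scoped ContDiff Laplacian RealInnerProductSpace ENNReal Topology

namespace Literature.Claims.NS.Kyritsis2022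

open Literature.Analysis.FluidPDE

noncomputable section

/-! ## Vocabulary (definitions with bodies; nothing asserted) -/

/-- A PARTICLE-TRAJECTORY (flow) map of the velocity `u` on the time set `S`, together with its
inverse: `X t` is the position at time `t` of the particle labelled by its position at time `0`,
`∂ₜX(t,a) = u(t, X(t,a))` (derivative within `S`), `X 0 = id`; each `X t`, `Y t` is `C^∞`, they are
mutually inverse, and both are volume preserving (`det ∇ₐX = 1`, incompressibility). This is the
object the paper uses as «the loop / surface / ball flows with the fluid» (pp. 2548–2555); the
fields are the printed properties of the trajectory map of a smooth divergence-free field.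
[cite: MajdaBertozziCUP2002, §1.3 eqs. (1.13)–(1.15), Prop. 1.2 and Prop. 1.4 (div v = 0 ⇔ J = 1 ⇔ volume preserving)] -/
structure IsFlowOn (S : Set ℝ) (u X Y : ℝ → EuclideanSpace ℝ (Fin 3) → EuclideanSpace ℝ (Fin 3)) :
    Prop where
  /-- Each time slice of the flow map is smooth. -/
  contDiff : ∀ t ∈ S, ContDiff ℝ ∞ (X t)
  /-- Each time slice of the inverse map is smooth. -/
  contDiff_inv : ∀ t ∈ S, ContDiff ℝ ∞ (Y t)
  /-- The trajectory equation `dX/dt = u(X, t)` within `S` (Majda–Bertozzi (1.13)). -/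
  hasDeriv : ∀ t ∈ S, ∀ a, HasDerivWithinAt (fun s => X s a) (u t (X t a)) S t
  /-- `X(·, 0) = id` (Majda–Bertozzi (1.13)). -/
  initial : X 0 = id
  /-- `Y t` is a left inverse of `X t`. -/
  leftInv : ∀ t ∈ S, ∀ a, Y t (X t a) = a
  /-- `Y t` is a right inverse of `X t`. -/
  rightInv : ∀ t ∈ S, ∀ x, X t (Y t x) = x
  /-- Volume preservation of the flow map, `det ∇ₐX(a,t) = 1` (Majda–Bertozzi (1.14)–(1.15), Prop. 1.4 (iii)). -/
  det : ∀ t ∈ S, ∀ a, (fderiv ℝ (X t) a).det = 1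
  /-- Volume preservation of the inverse map. -/
  det_inv : ∀ t ∈ S, ∀ x, (fderiv ℝ (Y t) x).det = 1

/-- Def. 4.1 (p. 2548–2549), round ball: the AVERAGE VORTICITY of `ω` on the ball `B(x, r)` along the
axis `a` — «the unique constant value of the vorticity on the interior of the ball that would give
the same 3D flux of vorticity on the ball» through the parallel discs normal to `a`, divided by `|B|`;
typed (height-integrated reading, the one under which the printed Lemmas 4.1, 4.2 hold for balls) as
the volume average `⨍_{B(x,r)} ⟪ω y, a⟫ dy`. [cite: Kyritsis2022, Def. 4.1 eq. (4.2), pp. 2548–2549] -/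
def ballAvg (ζ : EuclideanSpace ℝ (Fin 3) → EuclideanSpace ℝ (Fin 3)) (a x : EuclideanSpace ℝ (Fin 3))
    (r : ℝ) : ℝ :=
  ⨍ y in Metric.ball x r, ⟪ζ y, a⟫

/-- Def. 4.1 continued for «the flow-image of a ball» (p. 2549: «the disc surfaces will no longer be
flat, and the loop no longer perfect circle. But the integrals in the definition will be the same»)
and for Lemma 4.2's «any smooth 3D shape … as a diffeomorphic image of a spherical ball with its
spherical coordinates integration parametrization» (p. 2550): the height-integrated flux of `ω`
through the `Φ`-images of the discs of `B(x, r)` normal to `a`, divided by `|Φ(B)| = |B|`, for a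
volume-preserving `Φ` with inverse `Ψ`; by the cofactor identity this is the volume average over
`B(x,r)` of the pulled-back vorticity, `⨍_{B(x,r)} ⟪DΨ(Φ y) (ω (Φ y)), a⟫ dy`. For `Φ = Ψ = id` it is
`ballAvg` (`imageFluxAvg_id`). [cite: Kyritsis2022, Def. 4.1 and the paragraph after Remark 4.1, pp. 2548–2550] -/
def imageFluxAvg (ζ Φ Ψ : EuclideanSpace ℝ (Fin 3) → EuclideanSpace ℝ (Fin 3))
    (a x : EuclideanSpace ℝ (Fin 3)) (r : ℝ) : ℝ :=
  ⨍ y in Metric.ball x r, ⟪(fderiv ℝ Ψ (Φ y)) (ζ (Φ y)), a⟫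

/-- The image flux average for the identity parametrisation is the round-ball average
(definitional bookkeeping for Def. 4.1). [cite: Kyritsis2022, Def. 4.1, pp. 2548–2549] -/
theorem imageFluxAvg_id (ζ : EuclideanSpace ℝ (Fin 3) → EuclideanSpace ℝ (Fin 3))
    (a x : EuclideanSpace ℝ (Fin 3)) (r : ℝ) :
    imageFluxAvg ζ id id a x r = ballAvg ζ a x r := by
  simp [imageFluxAvg, ballAvg, fderiv_id]

/-! ## The claimed statement -/

/-- **The claimed theorem, as printed** (§5 «Millennium Homogeneous Case A», p. 2556; «Case B»,
p. 2557, with (2.10) = `u` AND `p` periodic, p. 2541; Remark 5.1, p. 2557: «we could as well take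
ν = 0»): Clay (A) ∧ Clay (B) in the CMI-errata reading ∧ the same two statements for the Euler
equations `ν = 0`. Stated over the schema of `ClayVariants.lean`: `clayR3.Regularity` is token-for-token
the summit statement (A). [cite: Kyritsis2022, §5 Cases (A) (B) and Remark 5.1, pp. 2556–2557] -/
def ClaimedTheorem : Prop :=
  ClayVariants.clayR3.Regularity ∧ ClayVariants.clayPeriodicErrata.Regularity ∧
    ClayVariants.clayR3.RegularityAt 0 ∧ ClayVariants.clayPeriodicErrata.RegularityAt 0

/-- The claimed theorem implies Clay (A) (its first conjunct; no delta on any axis).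
[cite: Kyritsis2022, §5 Case (A), p. 2556] -/
theorem clay_of_claimed (h : ClaimedTheorem) : ClayVariants.clayR3.Regularity :=
  h.1

/-- The claimed Case (B) is the errata reading (pressure periodic, (2.10) p. 2541), which implies the
printed Clay (B) leaf (`ClayVariants.clayPeriodicErrata_regularity_imp_printed`).
[cite: Kyritsis2022, §5 Case (B), p. 2557] -/
theorem clayB_of_claimed (h : ClaimedTheorem) : ClayVariants.clayPeriodic.Regularity :=
  ClayVariants.clayPeriodic_regularity_iff.mpr
    (ClayVariants.clayPeriodicErrata_regularity_imp_printed h.2.1)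

/-! ## The steps -/

/-- **Step 1 — Thm 2.1 with Remark 2.4 (pp. 2542–2543; the author cites Majda–Bertozzi Thm 3.4 and
Cor. 3.2): the local theory package.** For `ν ≥ 0` (Euler included) and a Clay datum (smooth,
divergence free, rapidly decaying) «there exists a maximal time T* (possibly infinite) of existence
of a unique smooth solution»: EITHER a global classical solution on `ℝ³ × [0,∞)` lying in the BKM
class `L^∞([0,T]; Hⁿ)` for every `T` and `n`, with bounded energy (2.7) and particle-trajectory maps
on every `[0,t]`, OR a classical solution on some `[0,T*)`, `0 < T* < ∞`, in the BKM class on every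
`[0,T'']`, `T'' < T*`, admitting no continuation in the class past `T*`, with trajectory maps on every
`[0,t]`, `t < T*`. (Uniqueness is not used downstream and is not typed; the energy bound (2.7) and the
trajectory maps are the parts of the standard local theory the paper uses tacitly in §5 and §4 —
«whatever else hypothesis is necessary», Thm 4.4 (1).) Typist's flag: plausible (known theory).
[cite: Kyritsis2022, Thm 2.1 and Remark 2.4, pp. 2542–2543] -/
def Step_1 : Prop :=
  ∀ ν : ℝ, 0 ≤ ν →
    ∀ u₀ : EuclideanSpace ℝ (Fin 3) → EuclideanSpace ℝ (Fin 3), ContDiff ℝ ∞ u₀ →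
      NSWave0.IsDivFree u₀ → HasRapidSpatialDecay u₀ →
      (∃ (u : ℝ → EuclideanSpace ℝ (Fin 3) → EuclideanSpace ℝ (Fin 3))
          (p : ℝ → EuclideanSpace ℝ (Fin 3) → ℝ),
          IsClassicalNSSolutionOn (Ici 0) ν 0 u p ∧ u 0 = u₀ ∧
            (∀ T : ℝ, HasBoundedSobolevNormsOn (Icc 0 T) u) ∧ HasBoundedEnergy u ∧
            ∀ t : ℝ, 0 ≤ t → ∃ X Y, IsFlowOn (Icc 0 t) u X Y) ∨
      (∃ T : ℝ, 0 < T ∧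
        ∃ (u : ℝ → EuclideanSpace ℝ (Fin 3) → EuclideanSpace ℝ (Fin 3))
          (p : ℝ → EuclideanSpace ℝ (Fin 3) → ℝ),
          IsClassicalNSSolutionOn (Ico 0 T) ν 0 u p ∧ u 0 = u₀ ∧
            (∀ T'' < T, HasBoundedSobolevNormsOn (Icc 0 T'') u) ∧ ¬ HasSobolevExtensionPast ν u T ∧
            ∀ t ∈ Ico 0 T, ∃ X Y, IsFlowOn (Icc 0 t) u X Y)

/-- **Step 2 — Thm 2.2 (p. 2543), «supremum of vorticity sufficient condition of regularity»
(the author cites Majda–Bertozzi Thm 3.6 = Beale–Kato–Majda): if the maximal time `T*` is finite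
then `∫₀^{T*} ‖ω(·,τ)‖_{L^∞} dτ = +∞` ((2.12)), for `ν ≥ 0`.** This IS, verbatim, the tree's
named fact `lintegral_iSup_curl_eq_top_of_not_hasSobolevExtensionPast` (Beale–Kato–Majda 1984,
Thm 1, blow-up form, in the BKM class), discharged in the tree by
`lintegral_iSup_curl_eq_top_of_not_hasSobolevExtensionPast_holds` (`NSVorticityBKMHolds.lean`).
Typist's flag: true (tree theorem). [cite: Kyritsis2022, Thm 2.2 eq. (2.12), p. 2543] -/
def Step_2 : Prop :=
  Literature.Analysis.FluidPDE.lintegral_iSup_curl_eq_top_of_not_hasSobolevExtensionPast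

/-- **Step 3 — Remark 2.1 (p. 2541):** «smooth Schwartz initial velocities after (2.4) will give
that the initial vorticity ω₀ = curl(u₀), in its supremum norm, is bounded over all 3-space».
Typist's flag: plausible (routine: (2.4) with |α| = 1, K = 0). [cite: Kyritsis2022, Remark 2.1, p. 2541] -/
def Step_3 : Prop :=
  ∀ u₀ : EuclideanSpace ℝ (Fin 3) → EuclideanSpace ℝ (Fin 3), ContDiff ℝ ∞ u₀ →
    HasRapidSpatialDecay u₀ → BddAbove (Set.range fun y => ‖curl u₀ y‖)

/-- **Step 4 — Lemma 3.1 (p. 2547), «the viscosity sign forgotten invariant», in the precise form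
in which it is invoked at (4.9)–(4.10) (p. 2552):** «If we integrate the force point density of the
viscosity over a line (1D work density) … its sign will remain the same during the flow»: for a
smooth Navier–Stokes solution (`ν > 0`, no force) on `[0,T]` with particle-trajectory maps, and any
closed `C¹` loop `γ` transported by the flow, the sign of the line integral of the viscous force
density `νΔu(t)` along the material loop `X t ∘ γ` is the same for all `t ∈ [0,T]`. (The printed
parenthesis «(negative)» depends on the orientation of the loop and is not typed; sign-CONSTANCY is
orientation-free.) Typist's flag: suspicious. [cite: Kyritsis2022, Lemma 3.1 p. 2547 and eqs. (4.9)–(4.10) p. 2552] -/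
def Step_4 : Prop :=
  ∀ ν : ℝ, 0 < ν → ∀ T : ℝ, 0 < T →
    ∀ (u : ℝ → EuclideanSpace ℝ (Fin 3) → EuclideanSpace ℝ (Fin 3))
      (p : ℝ → EuclideanSpace ℝ (Fin 3) → ℝ), IsClassicalNSSolutionOn (Icc 0 T) ν 0 u p →
    ∀ X Y : ℝ → EuclideanSpace ℝ (Fin 3) → EuclideanSpace ℝ (Fin 3), IsFlowOn (Icc 0 T) u X Y →
    ∀ γ : ℝ → EuclideanSpace ℝ (Fin 3), ContDiff ℝ 1 γ → γ 0 = γ 1 →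
    ∀ t ∈ Icc 0 T,
      Real.sign (circulation (fun x => ν • (Δ (u t)) x) (X t ∘ γ)) =
        Real.sign (circulation (fun x => ν • (Δ (u 0)) x) γ)

/-- **Step 5 — Lemma 4.1 (p. 2549):** «By taking the limit of shrinking the ball to its center x
(r → 0), the average vorticity ω_B converges to the point vorticity ωₓ [if the axis a is the axis of
ωₓ]; if the axis a … is not the axis of the point vorticity, then the limit of the average vorticity
will be equal to the projection component ωₐ(x, t) of the point vorticity on the axis a», for the
vorticity of a smooth velocity field. Typist's flag: plausible (continuity of `curl w`).
[cite: Kyritsis2022, Lemma 4.1, p. 2549] -/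
def Step_5 : Prop :=
  ∀ w : EuclideanSpace ℝ (Fin 3) → EuclideanSpace ℝ (Fin 3), ContDiff ℝ ∞ w →
    ∀ a x : EuclideanSpace ℝ (Fin 3),
      Tendsto (fun r : ℝ => ballAvg (curl w) a x r) (𝓝[>] 0) (𝓝 ⟪curl w x, a⟫)

/-- **Step 6 — Lemma 4.2 (4.3) (p. 2550), in its printed generality:** «Let … smooth initial data …
in the periodic or non-periodic case [no decay assumed], so that the supremum of the vorticity is
finite denoted by F_ω … Let the average vorticity … defined as in Definition 4.1 but with integration
parametrization on any smooth 3D shape B of any size, … as a diffeomorphic image of a spherical ball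
with its spherical coordinates integration parametrization. Then the average vorticity … is also
upper bounded by the F_ω: |ω_B| ≤ F_ω.» Typed: for every smooth divergence-free `w` with bounded
vorticity, every volume-preserving smooth diffeomorphism `Φ` (inverse `Ψ`), unit axis `a`, centre
`x`, radius `r > 0`: `imageFluxAvg (curl w) Φ Ψ a x r ≤ sup_y ‖curl w y‖`. (The printed proof uses
«∫₀^π ∬_S ds dθ = |B|», true for the round ball only; the instance `Φ = Ψ = id` is true.)
Typist's flag: known-false pattern (vortex stretching). [cite: Kyritsis2022, Lemma 4.2 eq. (4.3), p. 2550] -/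
def Step_6 : Prop :=
  ∀ w : EuclideanSpace ℝ (Fin 3) → EuclideanSpace ℝ (Fin 3), ContDiff ℝ ∞ w →
    VectorCalculus.IsDivFree w → BddAbove (Set.range fun y => ‖curl w y‖) →
    ∀ Φ Ψ : EuclideanSpace ℝ (Fin 3) → EuclideanSpace ℝ (Fin 3), ContDiff ℝ ∞ Φ → ContDiff ℝ ∞ Ψ →
      (∀ y, Ψ (Φ y) = y) → (∀ y, Φ (Ψ y) = y) →
      (∀ y, (fderiv ℝ Φ y).det = 1) → (∀ y, (fderiv ℝ Ψ y).det = 1) →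
    ∀ a : EuclideanSpace ℝ (Fin 3), ‖a‖ = 1 → ∀ x : EuclideanSpace ℝ (Fin 3), ∀ r : ℝ, 0 < r →
      imageFluxAvg (curl w) Φ Ψ a x r ≤ ⨆ y, ‖curl w y‖

/-- **Step 7 — Thm 4.1 (Helmholtz–Kelvin–Stokes for Euler, (4.1), p. 2548; the author cites
Majda–Bertozzi Prop. 1.11, Cor. 1.3) integrated over the disc family to Thm 4.2 ((4.4)–(4.5),
pp. 2550–2551), with the flow-image convention of p. 2549:** for a smooth EULER solution (`ν = 0`, no
force) on `[0,T]` with particle-trajectory maps `X`, `Y`, and ANY volume-preserving reference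
parametrisation `Φ` (inverse `Ψ`) of a body by the ball `B(x,r)`, the flux average of the vorticity
over the MATERIAL image `X t ∘ Φ` (inverse `Ψ ∘ Y t`) is constant in time: «ω_B(0) = ω_B(t)» (4.5).
(Equivalently Cauchy's formula `(∇X)⁻¹ ω(X,t) = ω₀` averaged.) Typist's flag: plausible (known).
[cite: Kyritsis2022, Thm 4.1 eq. (4.1) p. 2548 and Thm 4.2 eqs. (4.4)–(4.5) pp. 2550–2551] -/
def Step_7 : Prop :=
  ∀ T : ℝ, 0 < T →
    ∀ (u : ℝ → EuclideanSpace ℝ (Fin 3) → EuclideanSpace ℝ (Fin 3))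
      (p : ℝ → EuclideanSpace ℝ (Fin 3) → ℝ), IsClassicalNSSolutionOn (Icc 0 T) 0 0 u p →
    ∀ X Y : ℝ → EuclideanSpace ℝ (Fin 3) → EuclideanSpace ℝ (Fin 3), IsFlowOn (Icc 0 T) u X Y →
    ∀ Φ Ψ : EuclideanSpace ℝ (Fin 3) → EuclideanSpace ℝ (Fin 3), ContDiff ℝ ∞ Φ → ContDiff ℝ ∞ Ψ →
      (∀ y, Ψ (Φ y) = y) → (∀ y, Φ (Ψ y) = y) →
      (∀ y, (fderiv ℝ Φ y).det = 1) → (∀ y, (fderiv ℝ Ψ y).det = 1) →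
    ∀ a : EuclideanSpace ℝ (Fin 3), ‖a‖ = 1 → ∀ x : EuclideanSpace ℝ (Fin 3), ∀ r : ℝ, 0 < r →
    ∀ t ∈ Icc 0 T,
      imageFluxAvg (curl (u t)) (X t ∘ Φ) (Ψ ∘ Y t) a x r = imageFluxAvg (curl (u 0)) Φ Ψ a x r

/-- **Step 8 — Thm 4.3, loop form (4.6)/(4.10) (pp. 2551–2552):** for a smooth NAVIER–STOKES
solution (`ν > 0`, no force) on `[0,T]` with particle-trajectory maps, the circulation along a
material loop «is decreasing as both loop and surface flow with the fluid»:
«∮_c u(0) dl > ∮_{c(t)} u(t) dl» (4.6), «d/dt ∮_{c(t)} u dl < 0 for any t» (4.10), in the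
orientation «so that the circulation … is positive» (proof, p. 2552). Typed at a time `t ∈ (0,T]`
at which the circulation is positive (the instance consumed at (4.14)): it is then strictly smaller
than the initial circulation of the same material loop. (Alternative reading — orientation fixed by
positivity at time 0 — not typed.) Typist's flag: suspicious.
[cite: Kyritsis2022, Thm 4.3 eqs. (4.6) (4.9) (4.10), pp. 2551–2552] -/
def Step_8 : Prop :=
  ∀ ν : ℝ, 0 < ν → ∀ T : ℝ, 0 < T →
    ∀ (u : ℝ → EuclideanSpace ℝ (Fin 3) → EuclideanSpace ℝ (Fin 3))
      (p : ℝ → EuclideanSpace ℝ (Fin 3) → ℝ), IsClassicalNSSolutionOn (Icc 0 T) ν 0 u p →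
    ∀ X Y : ℝ → EuclideanSpace ℝ (Fin 3) → EuclideanSpace ℝ (Fin 3), IsFlowOn (Icc 0 T) u X Y →
    ∀ γ : ℝ → EuclideanSpace ℝ (Fin 3), ContDiff ℝ 1 γ → γ 0 = γ 1 →
    ∀ t ∈ Ioc 0 T, 0 < circulation (u t) (X t ∘ γ) →
      circulation (u t) (X t ∘ γ) < circulation (u 0) γ

/-- **Step 9 — Thm 4.3, ball form (4.7)/(4.8) (pp. 2552–2553):** «similarly for the 3D volume
integration as in Theorem 4.2 … ω_B(0) > ω_B(t)» for «initial finite spherical particles» and, with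
the flow-image convention of p. 2549, for their material images: for a smooth Navier–Stokes solution
(`ν > 0`, no force) on `[0,T]` with particle-trajectory maps and any volume-preserving reference
parametrisation `Φ`/`Ψ`, at a time `t ∈ (0,T]` at which the flux average over the material image is
positive, it is strictly smaller than at time `0`. This is the instance consumed at (4.14).
Typist's flag: suspicious. [cite: Kyritsis2022, Thm 4.3 eqs. (4.7)–(4.8), pp. 2552–2553] -/
def Step_9 : Prop :=
  ∀ ν : ℝ, 0 < ν → ∀ T : ℝ, 0 < T →
    ∀ (u : ℝ → EuclideanSpace ℝ (Fin 3) → EuclideanSpace ℝ (Fin 3))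
      (p : ℝ → EuclideanSpace ℝ (Fin 3) → ℝ), IsClassicalNSSolutionOn (Icc 0 T) ν 0 u p →
    ∀ X Y : ℝ → EuclideanSpace ℝ (Fin 3) → EuclideanSpace ℝ (Fin 3), IsFlowOn (Icc 0 T) u X Y →
    ∀ Φ Ψ : EuclideanSpace ℝ (Fin 3) → EuclideanSpace ℝ (Fin 3), ContDiff ℝ ∞ Φ → ContDiff ℝ ∞ Ψ →
      (∀ y, Ψ (Φ y) = y) → (∀ y, Φ (Ψ y) = y) →
      (∀ y, (fderiv ℝ Φ y).det = 1) → (∀ y, (fderiv ℝ Ψ y).det = 1) →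
    ∀ a : EuclideanSpace ℝ (Fin 3), ‖a‖ = 1 → ∀ x : EuclideanSpace ℝ (Fin 3), ∀ r : ℝ, 0 < r →
    ∀ t ∈ Ioc 0 T, 0 < imageFluxAvg (curl (u t)) (X t ∘ Φ) (Ψ ∘ Y t) a x r →
      imageFluxAvg (curl (u t)) (X t ∘ Φ) (Ψ ∘ Y t) a x r < imageFluxAvg (curl (u 0)) Φ Ψ a x r

/-- **Step 10 — the passage (4.13) → (4.14) (pp. 2554–2555), literal reading:** «Now we trace back
on the trajectory of the x_{tₙ} the parts of the (4.13). At initial time t = 0. We use the advantage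
that as the incompressible flow is volume preserving, the B(R, x₀) = B(R, x(tₙ)). We also utilize
theorems 4.2, 4.3 and (4.5), (4.8), which prove that at the initial conditions t = 0, this average
vorticity is the same or higher than that at tₙ: ∫₀^{2π}∬_S ω·ds dθ over B(R, x(0)) ≥ … over
B(R, x(tₙ))» — with `B(R, x(0))` the ROUND ball of the same radius about the initial position of the
particle, for Euler and Navier–Stokes alike (`ν ≥ 0`): along a particle trajectory the round-ball
average of the vorticity (any unit axis, any radius) at time `t` is at most its value at time `0`.
Typist's flag: known-false pattern (vortex stretching); NOT derivable from `Step_7`/`Step_9`, which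
compare a body with its material image. [cite: Kyritsis2022, proof of Thm 4.4, (4.13)–(4.14), pp. 2554–2555] -/
def Step_10 : Prop :=
  ∀ ν : ℝ, 0 ≤ ν → ∀ T : ℝ, 0 < T →
    ∀ (u : ℝ → EuclideanSpace ℝ (Fin 3) → EuclideanSpace ℝ (Fin 3))
      (p : ℝ → EuclideanSpace ℝ (Fin 3) → ℝ), IsClassicalNSSolutionOn (Icc 0 T) ν 0 u p →
    ∀ X Y : ℝ → EuclideanSpace ℝ (Fin 3) → EuclideanSpace ℝ (Fin 3), IsFlowOn (Icc 0 T) u X Y →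
    ∀ a : EuclideanSpace ℝ (Fin 3), ‖a‖ = 1 → ∀ x₀ : EuclideanSpace ℝ (Fin 3), ∀ R : ℝ, 0 < R →
    ∀ t ∈ Icc 0 T, ballAvg (curl (u t)) a (X t x₀) R ≤ ballAvg (curl (u 0)) a x₀ R

/-- **Thm 4.4, finite-time clause (pp. 2553–2555), printed scope:** «Let the Euler or Navier-Stokes
equations … (homogeneous case with no external forces), with 1) smooth initial data and whatever
else hypothesis is necessary so as, also to guarantee the existence and uniqueness of smooth
solutions … locally in time [0, T). 2) … the supremum of the vorticity, denoted by Fω, is finite at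
t = 0 … Then it holds that there cannot exist any finite … time blow-up at the point vorticities
during the flow.» No finite energy or decay is assumed (Remark 4.3, p. 2555), so ℤ³-periodic
solutions are included. Typed: for `ν ≥ 0`, every smooth unforced solution on `ℝ³ × [0,T)` with
particle-trajectory maps on each `[0,t]` and bounded initial vorticity has vorticity bounded on
`[0,T) × ℝ³`. [cite: Kyritsis2022, Thm 4.4 (finite time), pp. 2553–2555] -/
def Theorem44Finite : Prop :=
  ∀ ν : ℝ, 0 ≤ ν → ∀ T : ℝ, 0 < T →
    ∀ (u : ℝ → EuclideanSpace ℝ (Fin 3) → EuclideanSpace ℝ (Fin 3))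
      (p : ℝ → EuclideanSpace ℝ (Fin 3) → ℝ), IsClassicalNSSolutionOn (Ico 0 T) ν 0 u p →
    (∀ t ∈ Ico 0 T, ∃ X Y, IsFlowOn (Icc 0 t) u X Y) →
    BddAbove (Set.range fun y => ‖curl (u 0) y‖) →
    ∃ M : ℝ, ∀ t ∈ Ico 0 T, ∀ y, ‖curl (u t) y‖ ≤ M

/-- **Thm 4.4, infinite-time clause (pp. 2553–2555), printed scope:** «… there cannot exist any …
infinite time blow-up at the point vorticities» (also abstract, p. 2538: «there cannot be a blow up
in finite or infinite time»): for `ν ≥ 0`, every smooth unforced GLOBAL solution on `ℝ³ × [0,∞)`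
(no decay assumed, Remark 4.3) with particle-trajectory maps and bounded initial vorticity has
vorticity bounded on `[0,∞) × ℝ³`. [cite: Kyritsis2022, Thm 4.4 (infinite time), pp. 2553–2555] -/
def Theorem44Infinite : Prop :=
  ∀ ν : ℝ, 0 ≤ ν →
    ∀ (u : ℝ → EuclideanSpace ℝ (Fin 3) → EuclideanSpace ℝ (Fin 3))
      (p : ℝ → EuclideanSpace ℝ (Fin 3) → ℝ), IsClassicalNSSolutionOn (Ici 0) ν 0 u p →
    (∀ t : ℝ, 0 ≤ t → ∃ X Y, IsFlowOn (Icc 0 t) u X Y) →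
    BddAbove (Set.range fun y => ‖curl (u 0) y‖) →
    ∃ M : ℝ, ∀ t : ℝ, 0 ≤ t → ∀ y, ‖curl (u t) y‖ ≤ M

/-- **Step 11 — Thm 4.4 (pp. 2553–2555), «the no blow-up theorem in finite or infinite time in the
Euler, Navier-Stokes, periodic or non-periodic and homogeneous cases»**, both clauses, printed scope.
Typist's flag: the paper derives it from Steps 5–9 (see the compositions below for what composes).
[cite: Kyritsis2022, Thm 4.4, pp. 2553–2555] -/
def Step_11 : Prop :=
  Theorem44Finite ∧ Theorem44Infinite

/-- **Step 12 — the periodic twin of Steps 1–3 (Remarks 2.5 and 2.6, p. 2543: «Obviously this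
proposition covers the periodic case too»; Thm 4.4 hypothesis (2), p. 2554: «In the periodic case,
smoothness of the initial velocities is adequate to derive it [Fω < ∞]»; invoked in §5 Case (B),
p. 2557):** for `ν ≥ 0` and a smooth divergence-free ℤ³-periodic datum, the initial vorticity is
bounded, and EITHER there is a global classical solution on `ℝ³ × [0,∞)` with `u(·,t)` and `p(·,t)`
periodic and particle-trajectory maps on every `[0,t]`, OR there is a classical solution on some
`[0,T*)`, `0 < T* < ∞`, with `u(·,t)`, `p(·,t)` periodic and trajectory maps, along which the
vorticity accumulates: `∫₀^{T*} sup|curl u(t)| dt = +∞` ((2.12)). (Majda–Bertozzi Thm 3.4 / Cor. 3.2 /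
Thm 3.6 on the torus, read for periodic fields on `ℝ³`.) Typist's flag: plausible (known theory).
[cite: Kyritsis2022, Remarks 2.5–2.6 p. 2543, Thm 4.4 (2) p. 2554 and §5 Case (B) p. 2557] -/
def Step_12 : Prop :=
  ∀ ν : ℝ, 0 ≤ ν →
    ∀ u₀ : EuclideanSpace ℝ (Fin 3) → EuclideanSpace ℝ (Fin 3), ContDiff ℝ ∞ u₀ →
      NSWave0.IsDivFree u₀ → IsLatticePeriodic u₀ →
      BddAbove (Set.range fun y => ‖curl u₀ y‖) ∧
      ((∃ (u : ℝ → EuclideanSpace ℝ (Fin 3) → EuclideanSpace ℝ (Fin 3))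
          (p : ℝ → EuclideanSpace ℝ (Fin 3) → ℝ),
          IsClassicalNSSolutionOn (Ici 0) ν 0 u p ∧ u 0 = u₀ ∧
            (∀ t : ℝ, 0 ≤ t → IsLatticePeriodic (u t) ∧ IsLatticePeriodic (p t)) ∧
            ∀ t : ℝ, 0 ≤ t → ∃ X Y, IsFlowOn (Icc 0 t) u X Y) ∨
      (∃ T : ℝ, 0 < T ∧
        ∃ (u : ℝ → EuclideanSpace ℝ (Fin 3) → EuclideanSpace ℝ (Fin 3))
          (p : ℝ → EuclideanSpace ℝ (Fin 3) → ℝ),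
          IsClassicalNSSolutionOn (Ico 0 T) ν 0 u p ∧ u 0 = u₀ ∧
            (∀ t ∈ Ico 0 T, IsLatticePeriodic (u t) ∧ IsLatticePeriodic (p t)) ∧
            (∀ t ∈ Ico 0 T, ∃ X Y, IsFlowOn (Icc 0 t) u X Y) ∧
            (∫⁻ t in Ioo 0 T, ⨆ y, ‖curl (u t) y‖ₑ) = ⊤))

/-! ## Kernel compositions of the paper's implications -/

/-- Bookkeeping for the compositions: under a uniform vorticity bound on `(0,T)` the BKM integral
`∫₀ᵀ sup|curl u| dt` is finite. [folklore] -/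
private theorem lintegral_iSup_enorm_curl_lt_top {T M : ℝ}
    {u : ℝ → EuclideanSpace ℝ (Fin 3) → EuclideanSpace ℝ (Fin 3)}
    (hM : ∀ t ∈ Ioo 0 T, ∀ y, ‖curl (u t) y‖ ≤ M) :
    (∫⁻ t in Ioo 0 T, ⨆ y, ‖curl (u t) y‖ₑ) < ⊤ := by
  have hle : (∫⁻ t in Ioo 0 T, ⨆ y, ‖curl (u t) y‖ₑ) ≤ ∫⁻ _ in Ioo 0 T, ENNReal.ofReal M := by
    refine setLIntegral_mono' measurableSet_Ioo fun t ht => iSup_le fun y => ?_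
    rw [← ofReal_norm]
    exact ENNReal.ofReal_le_ofReal (hM t ht y)
  refine hle.trans_lt ?_
  rw [setLIntegral_const, Real.volume_Ioo]
  exact ENNReal.mul_lt_top ENNReal.ofReal_lt_top ENNReal.ofReal_lt_top

/-- **The proof of Thm 4.4 (finite time) COMPOSES under the material reading of (4.14)**
(pp. 2554–2555): a point `(t, y)` with `|ω(t,y)| > Fω` (negation of the conclusion), a unit axis
`a = ω/|ω|`, a radius `R` with round-ball average `> Fω` (Lemma 4.1 = `Step_5`), the identification
of the round ball at time `t` with the material image `X t ∘ Y t = id` of its flow preimage,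
conservation (Euler, `Step_7`) or strict decrease (Navier–Stokes, `Step_9`) of the flux average
from time `0`, and Lemma 4.2 in its printed generality (`Step_6`) applied to the preimage body
`Φ = Y t`, `Ψ = X t` give `Fω < Fω`. [cite: Kyritsis2022, proof of Thm 4.4, pp. 2554–2555] -/
theorem theorem44Finite_of_steps (h5 : Step_5) (h6 : Step_6) (h7 : Step_7) (h9 : Step_9) :
    Theorem44Finite := by
  intro ν hν T hT u p hsol hflow hbdd
  set F : ℝ := ⨆ y, ‖curl (u 0) y‖ with hF
  refine ⟨F, fun t ht y => ?_⟩
  by_contra hlt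
  rw [not_le] at hlt
  have hF0 : 0 ≤ F := Real.iSup_nonneg fun y => norm_nonneg _
  -- the unit axis of the large vorticity vector
  set v : EuclideanSpace ℝ (Fin 3) := curl (u t) y with hv
  have hvpos : 0 < ‖v‖ := hF0.trans_lt hlt
  have hv0 : v ≠ 0 := norm_pos_iff.mp hvpos
  set a : EuclideanSpace ℝ (Fin 3) := ‖v‖⁻¹ • v with ha
  have ha1 : ‖a‖ = 1 := by
    rw [ha, norm_smul, norm_inv, norm_norm, inv_mul_cancel₀ hvpos.ne']
  have hva : ⟪v, a⟫ = ‖v‖ := by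
    rw [ha, real_inner_smul_right, real_inner_self_eq_norm_sq]
    field_simp
  -- Lemma 4.1: a small round ball around `y` with average above `F`
  have hlim := h5 (u t) (hsol.contDiff_velocity ht) a y
  rw [← hv, hva] at hlim
  obtain ⟨R, hRpos, hR⟩ :=
    ((eventually_mem_nhdsWithin (a := (0 : ℝ)) (s := Ioi 0)).and
      (hlim.eventually_const_lt hlt)).exists
  rw [mem_Ioi] at hRpos
  -- the bound at time 0 for round balls (Lemma 4.2 with the identity parametrisation)
  have h0mem : (0 : ℝ) ∈ Ico 0 T := ⟨le_rfl, hT⟩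
  have hsm0 : ContDiff ℝ ∞ (u 0) := hsol.contDiff_velocity h0mem
  have hdiv0 : VectorCalculus.IsDivFree (u 0) := hsol.divFree 0 h0mem
  have hdetid : ∀ z : EuclideanSpace ℝ (Fin 3),
      (fderiv ℝ (id : EuclideanSpace ℝ (Fin 3) → EuclideanSpace ℝ (Fin 3)) z).det = 1 := by
    intro z
    rw [fderiv_id]
    simp [ContinuousLinearMap.det]
  rcases ht.1.eq_or_lt with h0t | ht0
  · -- t = 0: the round-ball average at time 0 is at most F
    subst h0t
    have hle := h6 (u 0) hsm0 hdiv0 hbdd id id contDiff_id contDiff_id (fun _ => rfl) (fun _ => rfl)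
      hdetid hdetid a ha1 y R hRpos
    rw [imageFluxAvg_id] at hle
    exact absurd (hR.trans_le hle) (lt_irrefl F)
  · -- 0 < t: go back along the flow
    obtain ⟨X, Y, hXY⟩ := hflow t ht
    have htt : t ∈ Icc 0 t := ⟨ht.1, le_rfl⟩
    have hsol' : IsClassicalNSSolutionOn (Icc 0 t) ν 0 u p :=
      hsol.mono (Icc_subset_Ico_right ht.2) (uniqueDiffOn_Icc ht0)
    have hid : X t ∘ Y t = id := funext (hXY.rightInv t htt)
    have hball : ballAvg (curl (u t)) a y R =
        imageFluxAvg (curl (u t)) (X t ∘ Y t) (X t ∘ Y t) a y R := by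
      rw [hid, imageFluxAvg_id]
    -- Lemma 4.2 (printed generality) for the preimage body Φ = Y t, Ψ = X t at time 0
    have h0 : imageFluxAvg (curl (u 0)) (Y t) (X t) a y R ≤ F :=
      h6 (u 0) hsm0 hdiv0 hbdd (Y t) (X t) (hXY.contDiff_inv t htt) (hXY.contDiff t htt)
        (hXY.rightInv t htt) (hXY.leftInv t htt) (hXY.det_inv t htt) (hXY.det t htt) a ha1 y R hRpos
    rcases hν.eq_or_lt with hν0 | hνpos
    · -- Euler: conservation (Thm 4.2)
      subst hν0
      have hcons := h7 t ht0 u p hsol' X Y hXY (Y t) (X t) (hXY.contDiff_inv t htt)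
        (hXY.contDiff t htt) (hXY.rightInv t htt) (hXY.leftInv t htt) (hXY.det_inv t htt)
        (hXY.det t htt) a ha1 y R hRpos t htt
      rw [← hball] at hcons
      exact absurd ((hR.trans_le (hcons.le.trans h0))) (lt_irrefl F)
    · -- Navier–Stokes: strict decrease (Thm 4.3)
      have hpos : 0 < imageFluxAvg (curl (u t)) (X t ∘ Y t) (X t ∘ Y t) a y R := by
        rw [← hball]
        exact hF0.trans_lt hR
      have hdec := h9 ν hνpos t ht0 u p hsol' X Y hXY (Y t) (X t) (hXY.contDiff_inv t htt)
        (hXY.contDiff t htt) (hXY.rightInv t htt) (hXY.leftInv t htt) (hXY.det_inv t htt)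
        (hXY.det t htt) a ha1 y R hRpos t ⟨ht0, le_rfl⟩ hpos
      rw [← hball] at hdec
      exact absurd (hR.trans (hdec.trans_le h0)) (lt_irrefl F)

/-- **The proof of Thm 4.4 (finite time) under the LITERAL round-ball reading of (4.14)**: the
decisive link is then `Step_10` (pp. 2554–2555) together with Lemma 4.1 (`Step_5`) and the
round-ball instance of Lemma 4.2 (`Step_6` at `Φ = id`). [cite: Kyritsis2022, proof of Thm 4.4, pp. 2554–2555] -/
theorem theorem44Finite_of_steps_literal (h5 : Step_5) (h6 : Step_6) (h10 : Step_10) :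
    Theorem44Finite := by
  intro ν hν T hT u p hsol hflow hbdd
  set F : ℝ := ⨆ y, ‖curl (u 0) y‖ with hF
  refine ⟨F, fun t ht y => ?_⟩
  by_contra hlt
  rw [not_le] at hlt
  have hF0 : 0 ≤ F := Real.iSup_nonneg fun y => norm_nonneg _
  set v : EuclideanSpace ℝ (Fin 3) := curl (u t) y with hv
  have hvpos : 0 < ‖v‖ := hF0.trans_lt hlt
  set a : EuclideanSpace ℝ (Fin 3) := ‖v‖⁻¹ • v with ha
  have ha1 : ‖a‖ = 1 := by
    rw [ha, norm_smul, norm_inv, norm_norm, inv_mul_cancel₀ hvpos.ne']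
  have hva : ⟪v, a⟫ = ‖v‖ := by
    rw [ha, real_inner_smul_right, real_inner_self_eq_norm_sq]
    field_simp
  have hlim := h5 (u t) (hsol.contDiff_velocity ht) a y
  rw [← hv, hva] at hlim
  obtain ⟨R, hRpos, hR⟩ :=
    ((eventually_mem_nhdsWithin (a := (0 : ℝ)) (s := Ioi 0)).and
      (hlim.eventually_const_lt hlt)).exists
  rw [mem_Ioi] at hRpos
  have h0mem : (0 : ℝ) ∈ Ico 0 T := ⟨le_rfl, hT⟩
  have hdetid : ∀ z : EuclideanSpace ℝ (Fin 3),
      (fderiv ℝ (id : EuclideanSpace ℝ (Fin 3) → EuclideanSpace ℝ (Fin 3)) z).det = 1 := by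
    intro z
    rw [fderiv_id]
    simp [ContinuousLinearMap.det]
  -- round balls at time 0 are bounded by F (Lemma 4.2, Φ = id)
  have hround : ∀ z, ballAvg (curl (u 0)) a z R ≤ F := by
    intro z
    have hle := h6 (u 0) (hsol.contDiff_velocity h0mem) (hsol.divFree 0 h0mem) hbdd id id
      contDiff_id contDiff_id (fun _ => rfl) (fun _ => rfl) hdetid hdetid a ha1 z R hRpos
    rwa [imageFluxAvg_id] at hle
  rcases ht.1.eq_or_lt with h0t | ht0
  · subst h0t
    exact absurd (hR.trans_le (hround y)) (lt_irrefl F)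
  · obtain ⟨X, Y, hXY⟩ := hflow t ht
    have htt : t ∈ Icc 0 t := ⟨ht.1, le_rfl⟩
    have hsol' : IsClassicalNSSolutionOn (Icc 0 t) ν 0 u p :=
      hsol.mono (Icc_subset_Ico_right ht.2) (uniqueDiffOn_Icc ht0)
    -- the particle that sits at `y` at time `t` started at `Y t y`
    have hback := h10 ν hν t ht0 u p hsol' X Y hXY a ha1 (Y t y) R hRpos t htt
    rw [hXY.rightInv t htt] at hback
    exact absurd (hR.trans_le (hback.trans (hround _))) (lt_irrefl F)

/-- **§5, Cases (A) and Remark 5.1 (pp. 2556–2557) COMPOSE from Thm 2.1, Thm 2.2, Remark 2.1 and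
Thm 4.4 (finite-time clause):** for `ν ≥ 0` and a Clay datum, either the maximal solution is global
— then it is a Clay-sense solution ((2.6) from the class, (2.7) from the energy bound of `Step_1`) —
or it lives on `[0,T*)`, `T* < ∞`, where Thm 4.4 bounds the vorticity, so the BKM integral is finite,
contradicting Thm 2.2. [cite: Kyritsis2022, §5 Case (A) and Remark 5.1, pp. 2556–2557] -/
theorem claimR3_of_steps (h1 : Step_1) (h2 : Step_2) (h3 : Step_3) (h11 : Step_11) :
    ClayVariants.clayR3.Regularity ∧ ClayVariants.clayR3.RegularityAt 0 := by
  have key : ∀ ν : ℝ, 0 ≤ ν → ClayVariants.clayR3.RegularityAt ν := by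
    intro ν hν u₀ hu₀ hdiv hdec
    rcases h1 ν hν u₀ hu₀ hdiv hdec with
      ⟨u, p, hsol, h0, -, hE, -⟩ | ⟨T, hT, u, p, hsol, h0, hreg, hmax, hflow⟩
    · exact ⟨u, p, hsol.smooth_velocity, hsol.smooth_pressure,
        ⟨fun t ht x => hsol.momentum t ht x, fun t ht => hsol.divFree t ht, h0⟩, hE⟩
    · exfalso
      have hbdd : BddAbove (Set.range fun y => ‖curl (u 0) y‖) := by
        rw [h0]
        exact h3 u₀ hu₀ hdec
      obtain ⟨M, hM⟩ := h11.1 ν hν T hT u p hsol hflow hbdd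
      have hfin := lintegral_iSup_enorm_curl_lt_top (T := T) (M := M) (u := u)
        fun t ht y => hM t ⟨ht.1.le, ht.2⟩ y
      have hinf : (∫⁻ t in Ioo 0 T, ⨆ y, ‖curl (u t) y‖ₑ) = ⊤ := h2 hν hT hsol hreg hmax
      exact hfin.ne hinf
  exact ⟨fun ν hν => key ν hν.le, key 0 le_rfl⟩

/-- §5 Case (A) / Remark 5.1 (pp. 2556–2557) at one viscosity `ν ≥ 0`, with Thm 4.4's finite-time
clause as an INPUT (`Theorem44Finite`, however obtained): either the maximal solution of `Step_1` is
global — then it is a Clay-sense solution ((2.6) from the class, (2.7) from the energy bound) — or it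
lives on `[0,T*)`, `T* < ∞`, where the vorticity bound makes the BKM integral finite, contradicting
Thm 2.2 (`Step_2`). [cite: Kyritsis2022, §5 Case (A) and Remark 5.1, pp. 2556–2557] -/
theorem clayR3_regularityAt_of_steps (h1 : Step_1) (h2 : Step_2) (h3 : Step_3)
    (h44 : Theorem44Finite) {ν : ℝ} (hν : 0 ≤ ν) : ClayVariants.clayR3.RegularityAt ν := by
  intro u₀ hu₀ hdiv hdec
  rcases h1 ν hν u₀ hu₀ hdiv hdec with
    ⟨u, p, hsol, h0, -, hE, -⟩ | ⟨T, hT, u, p, hsol, h0, hreg, hmax, hflow⟩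
  · exact ⟨u, p, hsol.smooth_velocity, hsol.smooth_pressure,
      ⟨fun t ht x => hsol.momentum t ht x, fun t ht => hsol.divFree t ht, h0⟩, hE⟩
  · exfalso
    have hbdd : BddAbove (Set.range fun y => ‖curl (u 0) y‖) := by
      rw [h0]
      exact h3 u₀ hu₀ hdec
    obtain ⟨M, hM⟩ := h44 ν hν T hT u p hsol hflow hbdd
    have hfin := lintegral_iSup_enorm_curl_lt_top (T := T) (M := M) (u := u)
      fun t ht y => hM t ⟨ht.1.le, ht.2⟩ y
    have hinf : (∫⁻ t in Ioo 0 T, ⨆ y, ‖curl (u t) y‖ₑ) = ⊤ := h2 hν hT hsol hreg hmax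
    exact hfin.ne hinf

/-- §5 Case (B) / Remark 5.1 (p. 2557) at one viscosity `ν ≥ 0`, from the periodic package `Step_12`
and Thm 4.4's finite-time clause («All the hypotheses of the no-blow-up theorem 4.4 are satisfied …
Thus from Theorem 2.2 … and remark 2.6 … this local in time [0,t] solution, can be extended in
[0,+∞)»). [cite: Kyritsis2022, §5 Case (B) and Remark 5.1, p. 2557] -/
theorem clayPeriodicErrata_regularityAt_of_steps (h12 : Step_12) (h44 : Theorem44Finite)
    {ν : ℝ} (hν : 0 ≤ ν) : ClayVariants.clayPeriodicErrata.RegularityAt ν := by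
  intro u₀ hu₀ hdiv hper
  obtain ⟨hbdd0, hcases⟩ := h12 ν hν u₀ hu₀ hdiv hper
  rcases hcases with ⟨u, p, hsol, h0, hperiodic, -⟩ | ⟨T, hT, u, p, hsol, h0, -, hflow, hinf⟩
  · exact ⟨u, p, hsol.smooth_velocity, hsol.smooth_pressure,
      ⟨fun t ht x => hsol.momentum t ht x, fun t ht => hsol.divFree t ht, h0⟩, hperiodic⟩
  · exfalso
    have hbdd : BddAbove (Set.range fun y => ‖curl (u 0) y‖) := by
      rw [h0]
      exact hbdd0
    obtain ⟨M, hM⟩ := h44 ν hν T hT u p hsol hflow hbdd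
    have hfin := lintegral_iSup_enorm_curl_lt_top (T := T) (M := M) (u := u)
      fun t ht y => hM t ⟨ht.1.le, ht.2⟩ y
    exact hfin.ne hinf

/-- **THE COMPOSITION (README Lean convention 4; hypotheses in step order).** The claimed theorem
(§5 Cases (A), (B), Remark 5.1, pp. 2556–2557) follows in the kernel from the twelve typed steps; the
proof CONSUMES `Step_1`, `Step_2`, `Step_3`, `Step_5`, `Step_6`, `Step_7`, `Step_9`, `Step_12` — Thm 4.4's
finite-time clause being re-derived from Lemmas 4.1/4.2 and Thms 4.2/4.3 by `theorem44Finite_of_steps`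
(material reading of (4.14)) — while `Step_4`, `Step_8` are the printed support of `Step_9`,
`Step_10` is the literal alternative to `Step_7 ∧ Step_9` + `Step_6` (`theorem44Finite_of_steps_literal`),
and `Step_11` (Thm 4.4 as printed) is bypassed (`claim_of_thm44` is §5's literal route through it).
[cite: Kyritsis2022, §5, pp. 2556–2557] -/
theorem claim_of_steps : Step_1 → Step_2 → Step_3 → Step_4 → Step_5 → Step_6 → Step_7 → Step_8 →
    Step_9 → Step_10 → Step_11 → Step_12 → ClaimedTheorem := by
  intro h1 h2 h3 _ h5 h6 h7 _ h9 _ _ h12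
  have h44 : Theorem44Finite := theorem44Finite_of_steps h5 h6 h7 h9
  exact ⟨fun _ hν => clayR3_regularityAt_of_steps h1 h2 h3 h44 hν.le,
    fun _ hν => clayPeriodicErrata_regularityAt_of_steps h12 h44 hν.le,
    clayR3_regularityAt_of_steps h1 h2 h3 h44 le_rfl,
    clayPeriodicErrata_regularityAt_of_steps h12 h44 le_rfl⟩

/-- **§5's literal route: the claimed theorem from Thm 2.1/2.2, Remark 2.1, Thm 4.4 AS PRINTED
(`Step_11`; only its finite-time clause is used) and the periodic package `Step_12`.**
[cite: Kyritsis2022, §5, pp. 2556–2557] -/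
theorem claim_of_thm44 (h1 : Step_1) (h2 : Step_2) (h3 : Step_3) (h11 : Step_11) (h12 : Step_12) :
    ClaimedTheorem :=
  ⟨fun _ hν => clayR3_regularityAt_of_steps h1 h2 h3 h11.1 hν.le,
    fun _ hν => clayPeriodicErrata_regularityAt_of_steps h12 h11.1 hν.le,
    clayR3_regularityAt_of_steps h1 h2 h3 h11.1 le_rfl,
    clayPeriodicErrata_regularityAt_of_steps h12 h11.1 le_rfl⟩

/-- **Step 2 HOLDS (kernel)**: Thm 2.2 (2.12) is the tree's Beale–Kato–Majda blow-up criterion,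
discharged in `NSVorticityBKMHolds.lean` (`beale_kato_majda_holds` ⇒ the blow-up form). Net Literature
debt −1; no statement of this file is changed. [cite: Kyritsis2022, Thm 2.2 eq. (2.12), p. 2543]
[cite: BealeKatoMajda1984, Theorem 1] -/
theorem step_2_holds : Step_2 :=
  lintegral_iSup_curl_eq_top_of_not_hasSobolevExtensionPast_holds

/-- A pointwise bound `‖curl v x‖ ≤ 6‖Dv(x)‖` (each of the three entries of the curl is a
difference of two entries of the Jacobian, each bounded by the operator norm; same private helper as
in `Kyritsis2017.lean`). [folklore] -/
private theorem norm_curl_le_six (v : EuclideanSpace ℝ (Fin 3) → EuclideanSpace ℝ (Fin 3))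
    (x : EuclideanSpace ℝ (Fin 3)) : ‖curl v x‖ ≤ 6 * ‖fderiv ℝ v x‖ := by
  have hD : ∀ j i : Fin 3, |fderiv ℝ v x (EuclideanSpace.single j 1) i| ≤ ‖fderiv ℝ v x‖ := by
    intro j i
    have h1 : |fderiv ℝ v x (EuclideanSpace.single j 1) i| ≤
        ‖fderiv ℝ v x (EuclideanSpace.single j 1)‖ := by
      simpa [Real.norm_eq_abs] using
        PiLp.norm_apply_le (fderiv ℝ v x (EuclideanSpace.single j 1)) i
    have h2 : ‖fderiv ℝ v x (EuclideanSpace.single j 1)‖ ≤ ‖fderiv ℝ v x‖ := by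
      simpa using (fderiv ℝ v x).le_opNorm (EuclideanSpace.single j (1 : ℝ))
    exact h1.trans h2
  have hc : ∀ i : Fin 3, |curl v x i| ≤ 2 * ‖fderiv ℝ v x‖ := by
    intro i
    fin_cases i
    · have := hD 1 2; have := hD 2 1
      simp [curl]
      calc |fderiv ℝ v x (EuclideanSpace.single 1 1) 2 - fderiv ℝ v x (EuclideanSpace.single 2 1) 1|
          ≤ |fderiv ℝ v x (EuclideanSpace.single 1 1) 2| +
            |fderiv ℝ v x (EuclideanSpace.single 2 1) 1| := abs_sub _ _
        _ ≤ 2 * ‖fderiv ℝ v x‖ := by linarith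
    · have := hD 2 0; have := hD 0 2
      simp [curl]
      calc |fderiv ℝ v x (EuclideanSpace.single 2 1) 0 - fderiv ℝ v x (EuclideanSpace.single 0 1) 2|
          ≤ |fderiv ℝ v x (EuclideanSpace.single 2 1) 0| +
            |fderiv ℝ v x (EuclideanSpace.single 0 1) 2| := abs_sub _ _
        _ ≤ 2 * ‖fderiv ℝ v x‖ := by linarith
    · have := hD 0 1; have := hD 1 0
      simp [curl]
      calc |fderiv ℝ v x (EuclideanSpace.single 0 1) 1 - fderiv ℝ v x (EuclideanSpace.single 1 1) 0|
          ≤ |fderiv ℝ v x (EuclideanSpace.single 0 1) 1| +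
            |fderiv ℝ v x (EuclideanSpace.single 1 1) 0| := abs_sub _ _
        _ ≤ 2 * ‖fderiv ℝ v x‖ := by linarith
  have hsq : ∀ i : Fin 3, ‖curl v x i‖ ^ 2 ≤ (2 * ‖fderiv ℝ v x‖) ^ 2 := fun i => by
    rw [Real.norm_eq_abs]
    exact pow_le_pow_left₀ (abs_nonneg _) (hc i) 2
  have hsum : ∑ i : Fin 3, ‖curl v x i‖ ^ 2 ≤ (6 * ‖fderiv ℝ v x‖) ^ 2 := by
    rw [Fin.sum_univ_three]
    have h0 := hsq 0; have h1 := hsq 1; have h2 := hsq 2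
    nlinarith [norm_nonneg (fderiv ℝ v x)]
  rw [EuclideanSpace.norm_eq]
  calc Real.sqrt (∑ i : Fin 3, ‖curl v x i‖ ^ 2) ≤ Real.sqrt ((6 * ‖fderiv ℝ v x‖) ^ 2) :=
        Real.sqrt_le_sqrt hsum
    _ = 6 * ‖fderiv ℝ v x‖ := Real.sqrt_sq (by positivity)

/-- **Step 3 HOLDS (kernel)** — Remark 2.1 (p. 2541): a smooth datum with Clay's decay (2.4)
(`HasRapidSpatialDecay`: every derivative bounded with every polynomial weight; here `|α| = 1`,
`K = 0`) has bounded vorticity, `sup |curl u₀| ≤ 6 · sup ‖Du₀‖`. Net Literature debt −1; no statement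
of this file is changed. [cite: Kyritsis2022, Remark 2.1, p. 2541] -/
theorem step_3_holds : Step_3 := by
  intro u₀ _ hdec
  obtain ⟨C, hC⟩ := hdec 1 0
  refine ⟨6 * C, ?_⟩
  rintro _ ⟨y, rfl⟩
  have h1 : ‖fderiv ℝ u₀ y‖ ≤ C := by
    have h := hC y
    rw [pow_zero, one_mul, norm_iteratedFDeriv_one (𝕜 := ℝ)] at h
    exact h
  calc ‖curl u₀ y‖ ≤ 6 * ‖fderiv ℝ u₀ y‖ := norm_curl_le_six u₀ y
    _ ≤ 6 * C := by linarith


/-! ## Step 5 discharged: Lemma 4.1 (ball averages of the vorticity converge to the point value) -/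

/-- **Averages of a continuous function over shrinking balls converge to its value** (Lebesgue's
differentiation theorem at a point of continuity, elementary form): for `f : ℝ³ → ℝ` continuous,
`⨍_{B(x,r)} f → f x` as `r → 0⁺`. [folklore] -/
private theorem tendsto_ballAverage_of_continuous {f : EuclideanSpace ℝ (Fin 3) → ℝ}
    (hf : Continuous f) (x : EuclideanSpace ℝ (Fin 3)) :
    Tendsto (fun r : ℝ => ⨍ y in Metric.ball x r, f y) (𝓝[>] 0) (𝓝 (f x)) := by
  rw [Metric.tendsto_nhdsWithin_nhds]
  intro ε hε
  obtain ⟨δ, hδ, hδf⟩ := Metric.continuous_iff.1 hf x (ε / 2) (half_pos hε)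
  refine ⟨δ, hδ, fun r hr hrδ => ?_⟩
  have hr0 : 0 < r := hr
  have hrδ' : r < δ := by
    rw [Real.dist_eq, sub_zero, abs_of_pos hr0] at hrδ
    exact hrδ
  set s := Metric.ball x r with hs
  have hμpos : 0 < volume.real s :=
    ENNReal.toReal_pos (Metric.measure_ball_pos volume x hr0).ne' measure_ball_lt_top.ne
  have hfin : volume s < (⊤ : ℝ≥0∞) := measure_ball_lt_top
  have hint : IntegrableOn f s volume :=
    (hf.continuousOn.integrableOn_compact (isCompact_closedBall x r)).mono_set
      Metric.ball_subset_closedBall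
  -- pointwise closeness on the ball
  have hclose : ∀ y ∈ s, ‖f y - f x‖ ≤ ε / 2 := fun y hy => by
    rw [← dist_eq_norm]
    exact (hδf y ((Metric.mem_ball.1 hy).trans hrδ')).le
  -- the average minus the value is the average of the difference
  have hdiff : (⨍ y in s, f y) - f x = (volume.real s)⁻¹ * ∫ y in s, (f y - f x) := by
    rw [setAverage_eq, smul_eq_mul, integral_sub hint (integrableOn_const hfin.ne),
      setIntegral_const, smul_eq_mul]
    field_simp
  rw [Real.dist_eq, hdiff, abs_mul, abs_inv, abs_of_pos hμpos]
  have hI : ‖∫ y in s, (f y - f x)‖ ≤ ε / 2 * volume.real s :=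
    norm_setIntegral_le_of_norm_le_const hfin hclose
  rw [Real.norm_eq_abs] at hI
  calc (volume.real s)⁻¹ * |∫ y in s, (f y - f x)|
      ≤ (volume.real s)⁻¹ * (ε / 2 * volume.real s) := by gcongr
    _ = ε / 2 := by field_simp
    _ < ε := half_lt_self hε

/-- **Step 5 HOLDS (kernel)** — Lemma 4.1 (p. 2549): the ball-average vorticity along an axis `a`
converges, as the ball shrinks to its centre, to the component `⟪ω(x), a⟫` of the point vorticity —
because the vorticity `curl w` of a smooth field is continuous (`continuous_curl`) and averages of a
continuous function over shrinking balls converge to its value. An in-file discharge of a step typed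
«plausible»; no statement of the file is modified. [cite: Kyritsis2022, Lemma 4.1, p. 2549] -/
theorem step_5_holds : Step_5 := by
  intro w hw a x
  have hfc : Continuous fun y => ⟪curl w y, a⟫ :=
    (continuous_curl (hw.of_le (by norm_cast))).inner continuous_const
  exact tendsto_ballAverage_of_continuous hfc x

end

end Literature.Claims.NS.Kyritsis2022
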